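import Summits.AtomisticToContinuum.Crystallization.Theorems.FreeSplittingCertificatesStrictSplittingRuleP1ReadSummable

/-!
# `StrictSplittingRule` (stmt-AtomisticToContinuum-12560): the ROUTED vertical readout RE-INDEXED into the leg table — one statement from the bond weights to the cell capacity family (P1 interpolant object, part 48)

Route `FreeSplittingCertificates`, crux r3 `StrictSplittingRule` (H12⋆ = `stub_coreJointCoercive`), unit b2b-freesplit-B gen 32.
VALUE = glue item **G6** of the kernel assembly map (HOME FAR-LEMMA-SPEC §23 (b), term (T5)): parts 38/40 route the readout of a bond `(q, q+s)` that is not a cell edge (the vertical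
Bravais bond `s = (2,0,0)`) through three intermediate sites `q + o q i`, producing six LEGS per bond with the factor `2/3`; parts 37/40 distribute LEG loads over carrier cells by a share
table.  In between sits a re-indexing: the leg family `{(q, o q i), (q + o q i, s − o q i)}_{q,i}` must become a weight function on ALL legs `e = (base, offset)`.  Here, for ANY offset
map `o : ℤ³ → Fin 3 → ℤ³` with values in a finite set and any nonnegative summable bond weights `wv`:
* `tsum_graph_reindex`, `tsum_graph2_reindex`, `summable_graph_iff`, `summable_graph2_iff` — re-indexing along the injective maps `q ↦ (q, o q)` and `q ↦ (q + o q, s − o q)`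
  (`Function.Injective.tsum_eq / summable_iff`);
* the ROUTED LEG WEIGHT `w'(e) = Σ_i (2/3)·([e.2 = o e.1 i]·wv e.1 + [o(e.1 − (s − e.2)) i = s − e.2]·wv(e.1 − (s − e.2)))`: **`tsum_routeWeight_readout_eq`** —
  `Σ'_e w'(e)·|V(e.1+e.2) − V e.1|² = Σ'_q (2/3)·wv q·Σ_i (|V(q+o q i) − V q|² + |V(q+s) − V(q+o q i)|²)` for the far-ledger field (both sides summable), and
  `summable_routeWeight_load` (its loads `w'(e)·|y_{e.1+e.2} − y_{e.1}|²` are summable);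
* **`tsum_readout_route_le_table_p1DispSite`**: for `V = p1DispSite a h U b₀ A` and ANY share table with the carrier property,
  `Σ'_q wv q·|V(q+s) − V q|² ≤ Σ'_T (Σᶠ_e θ e T·w'(e)·|y_{e.1+e.2} − y_{e.1}|²)·|G_T(U) − A|²_F` — bond weights → routed legs → cells in one kernel statement.
NOT a proof of H12⋆, NOT summit progress.  [folklore]
-/

noncomputable section

open Set Function
open scoped BigOperators

namespace Summit.AtomisticToContinuum.Crystallization.Theorems.StrictSplittingRuleBirth

open Literature.MathematicalPhysics.StatisticalMechanics
open Summit.AtomisticToContinuum.Crystallization.Theorems.PalmUnimodularRigidity.LayeredLawsSelectHcp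

/-! ## Re-indexing along graphs -/

/-- The map `q ↦ (q, o q)` is injective. -/
theorem injective_graph (o : (ℤ × ℤ × ℤ) → (ℤ × ℤ × ℤ)) : Function.Injective fun q : ℤ × ℤ × ℤ => (q, o q) :=
  fun _ _ hq => (Prod.ext_iff.1 hq).1

/-- The map `q ↦ (q + o q, s − o q)` is injective. -/
theorem injective_graph2 (o : (ℤ × ℤ × ℤ) → (ℤ × ℤ × ℤ)) (s : ℤ × ℤ × ℤ) :
    Function.Injective fun q : ℤ × ℤ × ℤ => (q + o q, s - o q) := by
  intro q q' hq
  obtain ⟨h1, h2⟩ := Prod.ext_iff.1 hq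
  have ho : o q = o q' := by simpa using h2
  simpa [ho] using h1

/-- **Re-indexing a leg family supported on the graph of `q ↦ (q, o q)`.** -/
theorem tsum_graph_reindex (o : (ℤ × ℤ × ℤ) → (ℤ × ℤ × ℤ)) (g : (ℤ × ℤ × ℤ) × (ℤ × ℤ × ℤ) → ℝ) :
    ∑' e : (ℤ × ℤ × ℤ) × (ℤ × ℤ × ℤ), (if e.2 = o e.1 then g e else 0) = ∑' q : ℤ × ℤ × ℤ, g (q, o q) := by
  rw [← (injective_graph o).tsum_eq (f := fun e : (ℤ × ℤ × ℤ) × (ℤ × ℤ × ℤ) => if e.2 = o e.1 then g e else 0) ?_]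
  · simp
  · intro e he
    rw [Function.mem_support] at he
    by_cases h2 : e.2 = o e.1
    · exact ⟨e.1, Prod.ext rfl h2.symm⟩
    · exact absurd (if_neg h2) he

/-- **Re-indexing a leg family supported on the graph of `q ↦ (q + o q, s − o q)`.** -/
theorem tsum_graph2_reindex (o : (ℤ × ℤ × ℤ) → (ℤ × ℤ × ℤ)) (s : ℤ × ℤ × ℤ) (g : (ℤ × ℤ × ℤ) × (ℤ × ℤ × ℤ) → ℝ) :
    ∑' e : (ℤ × ℤ × ℤ) × (ℤ × ℤ × ℤ), (if o (e.1 - (s - e.2)) = s - e.2 then g e else 0) =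
      ∑' q : ℤ × ℤ × ℤ, g (q + o q, s - o q) := by
  rw [← (injective_graph2 o s).tsum_eq
    (f := fun e : (ℤ × ℤ × ℤ) × (ℤ × ℤ × ℤ) => if o (e.1 - (s - e.2)) = s - e.2 then g e else 0) ?_]
  · refine tsum_congr fun q => ?_
    simp only [sub_sub_cancel, add_sub_cancel_right, if_true]
  · intro e he
    rw [Function.mem_support] at he
    by_cases h2 : o (e.1 - (s - e.2)) = s - e.2
    · refine ⟨e.1 - (s - e.2), Prod.ext ?_ ?_⟩
      · show e.1 - (s - e.2) + o (e.1 - (s - e.2)) = e.1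
        rw [h2]; abel
      · show s - o (e.1 - (s - e.2)) = e.2
        rw [h2]; abel
    · exact absurd (if_neg h2) he

/-- Summability along the graph of `q ↦ (q, o q)`. -/
theorem summable_graph_iff (o : (ℤ × ℤ × ℤ) → (ℤ × ℤ × ℤ)) (g : (ℤ × ℤ × ℤ) × (ℤ × ℤ × ℤ) → ℝ) :
    Summable (fun e : (ℤ × ℤ × ℤ) × (ℤ × ℤ × ℤ) => if e.2 = o e.1 then g e else 0) ↔ Summable fun q : ℤ × ℤ × ℤ => g (q, o q) := by
  rw [← (injective_graph o).summable_iff (f := fun e : (ℤ × ℤ × ℤ) × (ℤ × ℤ × ℤ) => if e.2 = o e.1 then g e else 0) ?_]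
  · exact summable_congr fun q => by simp
  · intro e he
    by_cases h2 : e.2 = o e.1
    · exact absurd ⟨e.1, Prod.ext rfl h2.symm⟩ he
    · exact if_neg h2

/-- Summability along the graph of `q ↦ (q + o q, s − o q)`. -/
theorem summable_graph2_iff (o : (ℤ × ℤ × ℤ) → (ℤ × ℤ × ℤ)) (s : ℤ × ℤ × ℤ) (g : (ℤ × ℤ × ℤ) × (ℤ × ℤ × ℤ) → ℝ) :
    Summable (fun e : (ℤ × ℤ × ℤ) × (ℤ × ℤ × ℤ) => if o (e.1 - (s - e.2)) = s - e.2 then g e else 0) ↔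
      Summable fun q : ℤ × ℤ × ℤ => g (q + o q, s - o q) := by
  rw [← (injective_graph2 o s).summable_iff
    (f := fun e : (ℤ × ℤ × ℤ) × (ℤ × ℤ × ℤ) => if o (e.1 - (s - e.2)) = s - e.2 then g e else 0) ?_]
  · exact summable_congr fun q => by simp only [Function.comp_apply, sub_sub_cancel, add_sub_cancel_right, if_true]
  · intro e he
    by_cases h2 : o (e.1 - (s - e.2)) = s - e.2
    · refine absurd ⟨e.1 - (s - e.2), Prod.ext ?_ ?_⟩ he
      · show e.1 - (s - e.2) + o (e.1 - (s - e.2)) = e.1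
        rw [h2]; abel
      · show s - o (e.1 - (s - e.2)) = e.2
        rw [h2]; abel
    · exact if_neg h2

/-! ## The routed leg weight of a bond family -/

/-- A bounded nonnegative family against nonnegative summable weights is summable. -/
theorem summable_mul_of_bounded {ι : Type*} {w g : ι → ℝ} (hw : ∀ i, 0 ≤ w i) (hws : Summable w) (hg0 : ∀ i, 0 ≤ g i) {B : ℝ}
    (hg : ∀ i, g i ≤ B) : Summable fun i => w i * g i :=
  Summable.of_nonneg_of_le (fun i => mul_nonneg (hw i) (hg0 i)) (fun i => mul_le_mul_of_nonneg_left (hg i) (hw i)) (hws.mul_right B)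

/-- **Re-indexing the routed legs**: for any nonnegative `g` on legs bounded on every fixed-offset fibre, intermediate offsets from a finite set `S`, and nonnegative summable
bond weights `wv`, the ROUTED LEG WEIGHT `w'(e) = Σ_i (2/3)([e.2 = o e.1 i]·wv e.1 + [o(e.1−(s−e.2)) i = s−e.2]·wv(e.1−(s−e.2)))` satisfies: `w'·g` is summable and
`Σ'_e w'(e)·g e = Σ'_q (2/3)·wv q·Σ_i (g(q, o q i) + g(q + o q i, s − o q i))`. -/
theorem tsum_routeWeight_eq {g : (ℤ × ℤ × ℤ) × (ℤ × ℤ × ℤ) → ℝ} (hg0 : ∀ e, 0 ≤ g e) (Bf : (ℤ × ℤ × ℤ) → ℝ) (hBf : ∀ q d, g (q, d) ≤ Bf d)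
    (s : ℤ × ℤ × ℤ) (o : (ℤ × ℤ × ℤ) → Fin 3 → ℤ × ℤ × ℤ) (S : Finset (ℤ × ℤ × ℤ)) (ho : ∀ q i, o q i ∈ S)
    (wv : ℤ × ℤ × ℤ → ℝ) (hwv : ∀ q, 0 ≤ wv q) (hwvs : Summable wv) :
    Summable (fun e : (ℤ × ℤ × ℤ) × (ℤ × ℤ × ℤ) =>
      (∑ i : Fin 3, (2 / 3) * ((if e.2 = o e.1 i then wv e.1 else 0) +
        (if o (e.1 - (s - e.2)) i = s - e.2 then wv (e.1 - (s - e.2)) else 0))) * g e) ∧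
    ∑' e : (ℤ × ℤ × ℤ) × (ℤ × ℤ × ℤ),
      (∑ i : Fin 3, (2 / 3) * ((if e.2 = o e.1 i then wv e.1 else 0) +
        (if o (e.1 - (s - e.2)) i = s - e.2 then wv (e.1 - (s - e.2)) else 0))) * g e =
    ∑' q : ℤ × ℤ × ℤ, 2 / 3 * wv q * ∑ i : Fin 3, (g (q, o q i) + g (q + o q i, s - o q i)) := by
  have hBf0 : ∀ d, 0 ≤ Bf d := fun d => (hg0 (0, d)).trans (hBf 0 d)
  -- uniform bounds on the two fibres
  set M : ℝ := ∑ d ∈ S, (Bf d + Bf (s - d)) with hM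
  have hM1 : ∀ q (i : Fin 3), g (q, o q i) ≤ M := fun q i =>
    ((hBf q (o q i)).trans (le_add_of_nonneg_right (hBf0 _))).trans
      (Finset.single_le_sum (f := fun d => Bf d + Bf (s - d)) (fun d _ => add_nonneg (hBf0 d) (hBf0 _)) (ho q i))
  have hM2 : ∀ q (i : Fin 3), g (q + o q i, s - o q i) ≤ M := fun q i =>
    ((hBf (q + o q i) (s - o q i)).trans (le_add_of_nonneg_left (hBf0 _))).trans
      (Finset.single_le_sum (f := fun d => Bf d + Bf (s - d)) (fun d _ => add_nonneg (hBf0 d) (hBf0 _)) (ho q i))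
  -- the six pieces as functions on legs
  set P1 : Fin 3 → (ℤ × ℤ × ℤ) × (ℤ × ℤ × ℤ) → ℝ := fun i e => if e.2 = o e.1 i then 2 / 3 * wv e.1 * g e else 0 with hP1
  set P2 : Fin 3 → (ℤ × ℤ × ℤ) × (ℤ × ℤ × ℤ) → ℝ := fun i e =>
    if o (e.1 - (s - e.2)) i = s - e.2 then 2 / 3 * wv (e.1 - (s - e.2)) * g e else 0 with hP2
  have hsplit : ∀ e : (ℤ × ℤ × ℤ) × (ℤ × ℤ × ℤ),
      (∑ i : Fin 3, (2 / 3) * ((if e.2 = o e.1 i then wv e.1 else 0) +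
        (if o (e.1 - (s - e.2)) i = s - e.2 then wv (e.1 - (s - e.2)) else 0))) * g e = ∑ i : Fin 3, (P1 i e + P2 i e) := by
    intro e
    rw [Finset.sum_mul]
    refine Finset.sum_congr rfl fun i _ => ?_
    simp only [hP1, hP2]
    split_ifs <;> ring
  -- summability and sums of the pieces
  have hs1 : ∀ i : Fin 3, Summable (P1 i) ∧ ∑' e, P1 i e = ∑' q, 2 / 3 * wv q * g (q, o q i) := by
    intro i
    have hq : Summable fun q : ℤ × ℤ × ℤ => 2 / 3 * wv q * g (q, o q i) :=
      summable_mul_of_bounded (fun q => by linarith [hwv q]) (hwvs.mul_left (2 / 3)) (fun q => hg0 _) (fun q => hM1 q i)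
    refine ⟨(summable_graph_iff (fun q => o q i) (fun e => 2 / 3 * wv e.1 * g e)).2 hq, ?_⟩
    exact tsum_graph_reindex (fun q => o q i) (fun e => 2 / 3 * wv e.1 * g e)
  have hs2 : ∀ i : Fin 3, Summable (P2 i) ∧ ∑' e, P2 i e = ∑' q, 2 / 3 * wv q * g (q + o q i, s - o q i) := by
    intro i
    have hq : Summable fun q : ℤ × ℤ × ℤ => 2 / 3 * wv q * g (q + o q i, s - o q i) :=
      summable_mul_of_bounded (fun q => by linarith [hwv q]) (hwvs.mul_left (2 / 3)) (fun q => hg0 _) (fun q => hM2 q i)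
    have e2 : ∀ q : ℤ × ℤ × ℤ, 2 / 3 * wv (q + o q i - (s - (s - o q i))) * g (q + o q i, s - o q i) = 2 / 3 * wv q * g (q + o q i, s - o q i) :=
      fun q => by rw [sub_sub_cancel, add_sub_cancel_right]
    refine ⟨(summable_graph2_iff (fun q => o q i) s (fun e => 2 / 3 * wv (e.1 - (s - e.2)) * g e)).2 (hq.congr fun q => (e2 q).symm), ?_⟩
    rw [hP2, tsum_graph2_reindex (fun q => o q i) s (fun e => 2 / 3 * wv (e.1 - (s - e.2)) * g e)]
    exact tsum_congr e2
  have hsum : Summable fun e : (ℤ × ℤ × ℤ) × (ℤ × ℤ × ℤ) => ∑ i : Fin 3, (P1 i e + P2 i e) :=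
    summable_sum fun i _ => (hs1 i).1.add (hs2 i).1
  have hfun : (fun e : (ℤ × ℤ × ℤ) × (ℤ × ℤ × ℤ) =>
      (∑ i : Fin 3, (2 / 3) * ((if e.2 = o e.1 i then wv e.1 else 0) +
        (if o (e.1 - (s - e.2)) i = s - e.2 then wv (e.1 - (s - e.2)) else 0))) * g e) = fun e => ∑ i : Fin 3, (P1 i e + P2 i e) :=
    funext hsplit
  refine ⟨by rw [hfun]; exact hsum, ?_⟩
  rw [hfun, Summable.tsum_finsetSum fun i _ => (hs1 i).1.add (hs2 i).1]
  have hq1 : ∀ i : Fin 3, Summable fun q : ℤ × ℤ × ℤ => 2 / 3 * wv q * g (q, o q i) := fun i =>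
    summable_mul_of_bounded (fun q => by linarith [hwv q]) (hwvs.mul_left (2 / 3)) (fun q => hg0 _) (fun q => hM1 q i)
  have hq2 : ∀ i : Fin 3, Summable fun q : ℤ × ℤ × ℤ => 2 / 3 * wv q * g (q + o q i, s - o q i) := fun i =>
    summable_mul_of_bounded (fun q => by linarith [hwv q]) (hwvs.mul_left (2 / 3)) (fun q => hg0 _) (fun q => hM2 q i)
  calc ∑ i : Fin 3, ∑' e, (P1 i e + P2 i e)
      = ∑ i : Fin 3, ((∑' q, 2 / 3 * wv q * g (q, o q i)) + ∑' q, 2 / 3 * wv q * g (q + o q i, s - o q i)) := by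
        refine Finset.sum_congr rfl fun i _ => ?_
        rw [(hs1 i).1.tsum_add (hs2 i).1, (hs1 i).2, (hs2 i).2]
    _ = ∑ i : Fin 3, ∑' q, (2 / 3 * wv q * g (q, o q i) + 2 / 3 * wv q * g (q + o q i, s - o q i)) := by
        refine Finset.sum_congr rfl fun i _ => ?_
        rw [(hq1 i).tsum_add (hq2 i)]
    _ = ∑' q, ∑ i : Fin 3, (2 / 3 * wv q * g (q, o q i) + 2 / 3 * wv q * g (q + o q i, s - o q i)) :=
        (Summable.tsum_finsetSum fun i _ => (hq1 i).add (hq2 i)).symm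
    _ = ∑' q : ℤ × ℤ × ℤ, 2 / 3 * wv q * ∑ i : Fin 3, (g (q, o q i) + g (q + o q i, s - o q i)) := by
        refine tsum_congr fun q => ?_
        rw [Finset.mul_sum]
        refine Finset.sum_congr rfl fun i _ => ?_
        ring

/-- The routed leg weight is nonnegative. -/
theorem routeWeight_nonneg (s : ℤ × ℤ × ℤ) (o : (ℤ × ℤ × ℤ) → Fin 3 → ℤ × ℤ × ℤ) (wv : ℤ × ℤ × ℤ → ℝ) (hwv : ∀ q, 0 ≤ wv q)
    (e : (ℤ × ℤ × ℤ) × (ℤ × ℤ × ℤ)) :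
    0 ≤ ∑ i : Fin 3, (2 / 3) * ((if e.2 = o e.1 i then wv e.1 else 0) + (if o (e.1 - (s - e.2)) i = s - e.2 then wv (e.1 - (s - e.2)) else 0)) :=
  Finset.sum_nonneg fun i _ => mul_nonneg (by norm_num) (add_nonneg (by split_ifs <;> simp [hwv]) (by split_ifs <;> simp [hwv]))

/-- **The loads of the routed leg weight are summable**: `Σ_e w'(e)·|y_{e.1+e.2} − y_{e.1}|² < ∞`.  NOT a proof of H12⋆, NOT summit progress. -/
theorem summable_routeWeight_load (a h : ℝ) (s : ℤ × ℤ × ℤ) (o : (ℤ × ℤ × ℤ) → Fin 3 → ℤ × ℤ × ℤ) (S : Finset (ℤ × ℤ × ℤ))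
    (ho : ∀ q i, o q i ∈ S) (wv : ℤ × ℤ × ℤ → ℝ) (hwv : ∀ q, 0 ≤ wv q) (hwvs : Summable wv) :
    Summable (fun e : (ℤ × ℤ × ℤ) × (ℤ × ℤ × ℤ) =>
      (∑ i : Fin 3, (2 / 3) * ((if e.2 = o e.1 i then wv e.1 else 0) +
        (if o (e.1 - (s - e.2)) i = s - e.2 then wv (e.1 - (s - e.2)) else 0))) *
        fpSq (fun k => hcpSite a h (e.1 + e.2) k - hcpSite a h e.1 k)) := by
  -- bond lengths² are bounded per offset, uniformly in the base site
  have hlen : ∀ q d : ℤ × ℤ × ℤ,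
      fpSq (fun k => hcpSite a h (q + d) k - hcpSite a h q k) ≤ 3 * (max ‖hcpSite a h d‖ ‖hcpSite a h (-d)‖) ^ 2 := by
    intro q d
    set L : ℝ := max ‖hcpSite a h d‖ ‖hcpSite a h (-d)‖ with hL
    have hc : ∀ k, |hcpSite a h (q + d) k - hcpSite a h q k| ≤ L := by
      intro k
      rw [← PiLp.sub_apply, h1_sub_eq a h q d]
      split_ifs with hq
      · exact ((Real.norm_eq_abs _).symm.le.trans (PiLp.norm_apply_le (hcpSite a h d) k)).trans (le_max_left _ _)
      · rw [PiLp.neg_apply, abs_neg]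
        exact ((Real.norm_eq_abs _).symm.le.trans (PiLp.norm_apply_le (hcpSite a h (-d)) k)).trans (le_max_right _ _)
    have hsq : ∀ k, (hcpSite a h (q + d) k - hcpSite a h q k) ^ 2 ≤ L ^ 2 := fun k =>
      sq_le_sq' (abs_le.1 (hc k)).1 (abs_le.1 (hc k)).2
    unfold fpSq
    linarith [hsq 0, hsq 1, hsq 2]
  exact (tsum_routeWeight_eq (g := fun e => fpSq (fun k => hcpSite a h (e.1 + e.2) k - hcpSite a h e.1 k)) (fun e => fpSq_nonneg _)
    (fun d => 3 * (max ‖hcpSite a h d‖ ‖hcpSite a h (-d)‖) ^ 2) (fun q d => hlen q d) s o S ho wv hwv hwvs).1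

/-- **THE ROUTED READOUT AS A LEG-LOAD SERIES, far-ledger field**: with `R e = |V(e.1+e.2) − V e.1|²`, `V = p1DispSite a h U b₀ A`, the family `w'·R` is summable and
`Σ'_e w'(e)·R e = Σ'_q (2/3)·wv q·Σ_i (R(q, o q i) + R(q + o q i, s − o q i))`.  NOT a proof of H12⋆, NOT summit progress. -/
theorem tsum_routeWeight_readout_eq {a h : ℝ} (ha : 0 < a) (hh : 0 < h) (U : ℤ × ℤ × ℤ → (Fin 3 → ℝ)) (hU : (support U).Finite)
    (b₀ : Fin 3 → ℝ) (A : Fin 3 → Fin 3 → ℝ) (s : ℤ × ℤ × ℤ) (o : (ℤ × ℤ × ℤ) → Fin 3 → ℤ × ℤ × ℤ) (S : Finset (ℤ × ℤ × ℤ))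
    (ho : ∀ q i, o q i ∈ S) (wv : ℤ × ℤ × ℤ → ℝ) (hwv : ∀ q, 0 ≤ wv q) (hwvs : Summable wv) :
    Summable (fun e : (ℤ × ℤ × ℤ) × (ℤ × ℤ × ℤ) =>
      (∑ i : Fin 3, (2 / 3) * ((if e.2 = o e.1 i then wv e.1 else 0) +
        (if o (e.1 - (s - e.2)) i = s - e.2 then wv (e.1 - (s - e.2)) else 0))) *
        fpSq (fun k => p1DispSite a h U b₀ A (e.1 + e.2) k - p1DispSite a h U b₀ A e.1 k)) ∧
    ∑' e : (ℤ × ℤ × ℤ) × (ℤ × ℤ × ℤ),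
      (∑ i : Fin 3, (2 / 3) * ((if e.2 = o e.1 i then wv e.1 else 0) +
        (if o (e.1 - (s - e.2)) i = s - e.2 then wv (e.1 - (s - e.2)) else 0))) *
        fpSq (fun k => p1DispSite a h U b₀ A (e.1 + e.2) k - p1DispSite a h U b₀ A e.1 k) =
    ∑' q : ℤ × ℤ × ℤ, 2 / 3 * wv q * ∑ i : Fin 3,
      (fpSq (fun k => p1DispSite a h U b₀ A (q + o q i) k - p1DispSite a h U b₀ A q k) +
        fpSq (fun k => p1DispSite a h U b₀ A (q + s) k - p1DispSite a h U b₀ A (q + o q i) k)) := by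
  have hb : ∀ d : ℤ × ℤ × ℤ, ∃ B : ℝ, ∀ q, fpSq (fun k => p1DispSite a h U b₀ A (q + d) k - p1DispSite a h U b₀ A q k) ≤ B := fun d =>
    exists_bound_readout_p1DispSite ha hh U hU b₀ A d
  choose Bf hBf using hb
  have hmain := tsum_routeWeight_eq (g := fun e => fpSq (fun k => p1DispSite a h U b₀ A (e.1 + e.2) k - p1DispSite a h U b₀ A e.1 k))
    (fun e => fpSq_nonneg _) Bf (fun q d => hBf d q) s o S ho wv hwv hwvs
  simp only [add_add_sub_cancel] at hmain
  exact hmain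

/-! ## Bond weights → routed legs → cells, in one statement -/

/-- **THE ROUTED READOUT OVER AN ALLOCATION TABLE, far-ledger field**: for `V = p1DispSite a h U b₀ A` (`U` finitely supported), a bond offset `s`, intermediate offsets `o q i` from a
finite set, nonnegative summable bond weights `wv`, and ANY share table `θ` (nonnegative, finite sections, unit row sums, carrier property),
`Σ'_q wv q·|V(q+s) − V q|² ≤ Σ'_T (Σᶠ_e θ e T·w'(e)·|y_{e.1+e.2} − y_{e.1}|²)·|G_T(U) − A|²_F` with the routed leg weight `w'`, both sides summable.
NOT a proof of H12⋆, NOT summit progress. -/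
theorem tsum_readout_route_le_table_p1DispSite {a h : ℝ} (ha : 0 < a) (hh : 0 < h) (U : ℤ × ℤ × ℤ → (Fin 3 → ℝ))
    (hU : (support U).Finite) (b₀ : Fin 3 → ℝ) (A : Fin 3 → Fin 3 → ℝ) (s : ℤ × ℤ × ℤ)
    (o : (ℤ × ℤ × ℤ) → Fin 3 → ℤ × ℤ × ℤ) (S : Finset (ℤ × ℤ × ℤ)) (ho : ∀ q i, o q i ∈ S)
    (wv : ℤ × ℤ × ℤ → ℝ) (hwv : ∀ q, 0 ≤ wv q) (hwvs : Summable wv)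
    (θ : (ℤ × ℤ × ℤ) × (ℤ × ℤ × ℤ) → (ℤ × ℤ × ℤ) × Fin 6 → ℝ) (hθ : ∀ e T, 0 ≤ θ e T)
    (hfinE : ∀ e, (Function.support (θ e)).Finite) (hfinC : ∀ T, (Function.support fun e => θ e T).Finite)
    (hsum : ∀ e, ∑ᶠ T, θ e T = 1)
    (hcar : ∀ e T, θ e T ≠ 0 → ∃ m m' : Fin 4, e.1 = T.1 + p1VertOff (p1Par T.1) T.2 m ∧
      e.1 + e.2 = T.1 + p1VertOff (p1Par T.1) T.2 m') :
    Summable (fun q : ℤ × ℤ × ℤ => wv q * fpSq (fun k => p1DispSite a h U b₀ A (q + s) k - p1DispSite a h U b₀ A q k)) ∧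
    ∑' q : ℤ × ℤ × ℤ, wv q * fpSq (fun k => p1DispSite a h U b₀ A (q + s) k - p1DispSite a h U b₀ A q k) ≤
    ∑' T : (ℤ × ℤ × ℤ) × Fin 6,
      (∑ᶠ e : (ℤ × ℤ × ℤ) × (ℤ × ℤ × ℤ), θ e T *
        (∑ i : Fin 3, (2 / 3) * ((if e.2 = o e.1 i then wv e.1 else 0) +
          (if o (e.1 - (s - e.2)) i = s - e.2 then wv (e.1 - (s - e.2)) else 0))) *
        fpSq (fun k => hcpSite a h (e.1 + e.2) k - hcpSite a h e.1 k)) *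
        fpFrob (fun j k => p1CellGrad a h U T j k - A j k) := by
  obtain ⟨_, hS1, hle1⟩ := tsum_readout_route_le_legs_p1DispSite ha hh U hU b₀ A s o S ho wv hwv hwvs
  obtain ⟨_, heq⟩ := tsum_routeWeight_readout_eq ha hh U hU b₀ A s o S ho wv hwv hwvs
  obtain ⟨_, _, hle2⟩ := tsum_readout_leg_table_le_p1DispSite ha hh U hU b₀ A _ (routeWeight_nonneg s o wv hwv) θ hθ hfinE hfinC hsum hcar
    (summable_routeWeight_load a h s o S ho wv hwv hwvs)
  refine ⟨hS1, hle1.trans ?_⟩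
  rw [← heq]
  exact hle2

end Summit.AtomisticToContinuum.Crystallization.Theorems.StrictSplittingRuleBirth

end
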